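import Summits.NavierStokesRegularity.NavierStokesRegularity.Theorems.ExtremiserTransienceBangBangCoreDefs
import Literature.Analysis.FluidPDE.SobolevWholeSpace
import Literature.Analysis.FluidPDE.TaoEnstrophyLocalisationProofs
import Literature.Analysis.FluidPDE.BKMClassEnstrophyContinuity
import Literature.Analysis.FluidPDE.NSVorticityDifference
import Literature.Analysis.FluidPDE.EnstrophySplitting
import Mathlib.MeasureTheory.Measure.Lebesgue.EqHaar
import HarnessLib

/-!
# Route `ExtremiserTransience`, crux `NearExtremalTransiencePerFlow` (stmt-NavierStokesRegularity-26567), LINE g8-β «analytic gap»: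
# STUB P-C `PlateauSobolevCost` PROVED (statement verbatim)

`--supports stmt-NavierStokesRegularity-26567` (helper: LINE g8-β = crux workfile `Cruxes/NearExtremalTransiencePerFlow/Lines/analytic_gap.lean`,
PASS idea-crit-4 2026-08-28T21:45:37Z; not the registered skeleton of record).  Author: prover seat `ns-net-p1` (g2).

`plateauSobolevCost` = the workfile's `def PlateauSobolevCost` VERBATIM (over the tree's `KStar.HalfSpace.Zen` and `KStar.BangBang.{IsAdm, lam}`),
so in the workfile `theorem stub_plateauSobolevCost : PlateauSobolevCost := plateauSobolevCost` closes by definitional unfolding: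
there is an absolute `c > 0` such that an admissible field (`C^∞`, divergence free, `‖v‖ ≤ M`, `D⁰v, D¹v, D²v ∈ L²`) with `‖v‖ ≥ M/2` on a
ball `B(x₀, R·λ)` (`λ = λ(v) = √(Z/W)`) pays `c·(Rλ)·M² ≤ Z = ‖curl v‖₂²`.

PROOF («`L²` fields cannot afford large half-plateaus cheaply»).  `‖M/2‖·vol(B)^{1/6} = ‖𝟙_B·M/2‖₆ ≤ ‖v‖₆` (monotonicity of `L⁶`);
whole-space Sobolev `‖v‖₆ ≤ K‖Dv‖₂` for `C¹ ∩ L²` fields in dimension three (tree: `FluidPDE.eLpNorm_six_le_eLpNorm_fderiv_two`, no compact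
support needed); `‖Dv‖₂² ≤ ∫|∇v|²_F ≤ ‖curl v‖₂² = Z` for divergence-free `L²` fields (operator ≤ Frobenius norm, tree
`lintegral_frobeniusNormSq_fderiv_le_lintegral_sq_norm_curl`); `vol B(x₀,r) = r³·vol B(0,1)`; squaring,
`(M/2)²·r·vol(B(0,1))^{1/3} ≤ K²·Z`, i.e. the claim with `c = vol(B(0,1))^{1/3}/(4(K+1)²)`.
HONEST FRAMING: an elementary Sobolev-capacity inequality; nothing about Navier–Stokes regularity or blow-up is proved; no summit is proved
by a line. [folklore]
-/

noncomputable section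

open scoped Topology InnerProductSpace RealInnerProductSpace ENNReal NNReal ContDiff
open MeasureTheory Filter Set Metric Function
open Literature.Analysis Literature.Analysis.FluidPDE
open Summit.NavierStokesRegularity.NavierStokesRegularity.Theorems.DepletionLadder.KStar
open Summit.NavierStokesRegularity.NavierStokesRegularity.Theorems.DepletionLadder.KStar.HalfSpace
open Summit.NavierStokesRegularity.NavierStokesRegularity.Theorems.DepletionLadder.KStar.BangBang

namespace Summit.NavierStokesRegularity.NavierStokesRegularity.Theorems.NearExtremalTransiencePerFlow.AnalyticGap

-- the problem directory repeats the summit name (`NavierStokesRegularity/NavierStokesRegularity`)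
set_option linter.dupNamespace false

/-- **P-C `PlateauSobolevCost` (LINE g8-β), proved** — statement verbatim: an absolute `c > 0` with `c·(R·λ)·M² ≤ Z` whenever an admissible
field has `‖v‖ ≥ M/2` on a ball of radius `R·λ(v)`.  Sobolev `L⁶` capacity of a ball in `ℝ³` is linear in the radius. [folklore] -/
theorem plateauSobolevCost :
    ∃ c : ℝ, 0 < c ∧ ∀ (v : E3 → E3) (M B R : ℝ) (x₀ : E3), IsAdm v M B → 0 < M → 0 < R → 0 < lam v →
      (∀ x ∈ Metric.ball x₀ (R * lam v), M / 2 ≤ ‖v x‖) → c * (R * lam v) * M ^ 2 ≤ Zen v := by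
  -- the constants: Sobolev constant `K` and the volume `w` of the unit ball
  set K : ℝ≥0 := MeasureTheory.SNormLESNormFDerivOfEqConst E3 (volume : Measure E3) 2 with hKdef
  have hV₁pos : 0 < volume (Metric.ball (0 : E3) 1) := Metric.measure_ball_pos volume (0 : E3) one_pos
  have hV₁top : volume (Metric.ball (0 : E3) 1) < ⊤ := measure_ball_lt_top
  set w : ℝ := (volume (Metric.ball (0 : E3) 1)).toReal with hwdef
  have hw : 0 < w := ENNReal.toReal_pos hV₁pos.ne' hV₁top.ne
  have hV₁w : volume (Metric.ball (0 : E3) 1) = ENNReal.ofReal w := (ENNReal.ofReal_toReal hV₁top.ne).symm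
  have hK0 : 0 ≤ (K : ℝ) := K.coe_nonneg
  refine ⟨w ^ ((1 : ℝ) / 3) / (4 * ((K : ℝ) + 1) ^ 2), by positivity, ?_⟩
  intro v M B R x₀ hAdm hM hR hlam hplat
  obtain ⟨hcd, hdiv, hvM, hvB, h0, h1, h2⟩ := hAdm
  have hcd2 : ContDiff ℝ 2 v := hcd.of_le (by norm_cast)
  have hcd1 : ContDiff ℝ 1 v := hcd.of_le (by norm_cast)
  set r : ℝ := R * lam v with hrdef
  have hr : 0 < r := mul_pos hR hlam
  set s : Set E3 := Metric.ball x₀ r with hsdef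
  have hs : MeasurableSet s := Metric.isOpen_ball.measurableSet
  have hZ0 : 0 ≤ Zen v := integral_nonneg fun x => sq_nonneg _
  -- `v ∈ L²`
  have h0' : ∫⁻ x, ‖v x‖ₑ ^ 2 < ⊤ := by
    refine lt_of_le_of_lt (le_of_eq (lintegral_congr fun x => ?_)) h0
    rw [← ofReal_norm, ← ofReal_norm, norm_iteratedFDeriv_zero]
  -- (1) the half-plateau: `‖M/2‖ₑ · vol(s)^{1/6} ≤ ‖v‖₆`
  have hlow : ‖(M / 2 : ℝ)‖ₑ * volume s ^ (1 / (6 : ℝ≥0∞).toReal) ≤ eLpNorm v 6 volume := by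
    rw [← eLpNorm_indicator_const hs (by norm_num) (by norm_num)]
    refine eLpNorm_mono fun x => ?_
    by_cases hx : x ∈ s
    · rw [Set.indicator_of_mem hx, Real.norm_of_nonneg (by positivity)]; exact hplat x hx
    · rw [Set.indicator_of_notMem hx, norm_zero]; exact norm_nonneg _
  -- (2) whole-space Sobolev `‖v‖₆ ≤ K ‖Dv‖₂`
  have hsob : eLpNorm v 6 volume ≤ (K : ℝ≥0∞) * eLpNorm (fderiv ℝ v) 2 volume :=
    eLpNorm_six_le_eLpNorm_fderiv_two volume finrank_euclideanSpace_fin hcd1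
      (eLpNorm_two_lt_top_of_lintegral_enorm_sq_lt_top h0')
  -- (3) `‖Dv‖₂² ≤ Z`
  have hgradsq : eLpNorm (fderiv ℝ v) 2 volume ^ 2 ≤ ENNReal.ofReal (Zen v) := by
    rw [← lintegral_enorm_sq_eq_eLpNorm_two_sq]
    calc ∫⁻ x, ‖fderiv ℝ v x‖ₑ ^ 2 ≤ ∫⁻ x, ENNReal.ofReal (frobeniusNormSq (fderiv ℝ v x)) :=
          lintegral_mono fun x => sq_enorm_le_ofReal_frobeniusNormSq _
      _ ≤ ∫⁻ x, ‖curl v x‖ₑ ^ 2 := lintegral_frobeniusNormSq_fderiv_le_lintegral_sq_norm_curl hcd2 hdiv h0'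
      _ = ENNReal.ofReal (Zen v) := lintegral_enorm_curl_sq_eq_ofReal_integral hcd2 h1
  have hgrad : eLpNorm (fderiv ℝ v) 2 volume ≤ ENNReal.ofReal (Zen v) ^ ((1 : ℝ) / 2) := by
    have e : (eLpNorm (fderiv ℝ v) 2 volume ^ 2) ^ ((1 : ℝ) / 2) = eLpNorm (fderiv ℝ v) 2 volume := by
      rw [← ENNReal.rpow_two, ← ENNReal.rpow_mul]; norm_num
    calc eLpNorm (fderiv ℝ v) 2 volume = (eLpNorm (fderiv ℝ v) 2 volume ^ 2) ^ ((1 : ℝ) / 2) := e.symm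
      _ ≤ ENNReal.ofReal (Zen v) ^ ((1 : ℝ) / 2) := ENNReal.rpow_le_rpow hgradsq (by norm_num)
  -- (4) the chain in `ℝ≥0∞`, then in `ℝ`
  have hchain : ‖(M / 2 : ℝ)‖ₑ * volume s ^ (1 / (6 : ℝ≥0∞).toReal) ≤
      (K : ℝ≥0∞) * ENNReal.ofReal (Zen v) ^ ((1 : ℝ) / 2) :=
    hlow.trans (hsob.trans (mul_le_mul' le_rfl hgrad))
  have hvol : volume s = ENNReal.ofReal (r ^ 3 * w) := by
    rw [hsdef, Measure.addHaar_ball volume x₀ hr.le, finrank_euclideanSpace_fin, hV₁w,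
      ← ENNReal.ofReal_mul (by positivity)]
  have hlhs : ‖(M / 2 : ℝ)‖ₑ * volume s ^ (1 / (6 : ℝ≥0∞).toReal) =
      ENNReal.ofReal (M / 2 * (r ^ 3 * w) ^ ((1 : ℝ) / 6)) := by
    rw [Real.enorm_eq_ofReal (by positivity), hvol, show (1 / (6 : ℝ≥0∞).toReal) = (1 : ℝ) / 6 by norm_num,
      ENNReal.ofReal_rpow_of_nonneg (by positivity) (by norm_num), ← ENNReal.ofReal_mul (by positivity)]
  have hrhs : (K : ℝ≥0∞) * ENNReal.ofReal (Zen v) ^ ((1 : ℝ) / 2) = ENNReal.ofReal ((K : ℝ) * Zen v ^ ((1 : ℝ) / 2)) := by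
    rw [ENNReal.ofReal_rpow_of_nonneg hZ0 (by norm_num), ENNReal.ofReal_mul hK0, ENNReal.ofReal_coe_nnreal]
  rw [hlhs, hrhs, ENNReal.ofReal_le_ofReal_iff (by positivity)] at hchain
  -- (5) square: `(M/2)² · r · w^{1/3} ≤ K² · Z`
  have hsq := pow_le_pow_left₀ (by positivity) hchain 2
  have e1 : (M / 2 * (r ^ 3 * w) ^ ((1 : ℝ) / 6)) ^ 2 = (M / 2) ^ 2 * (r * w ^ ((1 : ℝ) / 3)) := by
    have h6 : ((r ^ 3 * w) ^ ((1 : ℝ) / 6)) ^ 2 = (r ^ 3 * w) ^ ((1 : ℝ) / 3) := by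
      rw [← Real.rpow_two, ← Real.rpow_mul (by positivity)]; norm_num
    have h3 : (r ^ 3 * w) ^ ((1 : ℝ) / 3) = r * w ^ ((1 : ℝ) / 3) := by
      rw [Real.mul_rpow (by positivity) hw.le, show ((1 : ℝ) / 3) = ((3 : ℕ) : ℝ)⁻¹ by norm_num,
        Real.pow_rpow_inv_natCast hr.le (by norm_num)]
    rw [mul_pow, h6, h3]
  have e2 : ((K : ℝ) * Zen v ^ ((1 : ℝ) / 2)) ^ 2 = (K : ℝ) ^ 2 * Zen v := by
    rw [mul_pow, show ((1 : ℝ) / 2) = ((2 : ℕ) : ℝ)⁻¹ by norm_num, Real.rpow_inv_natCast_pow hZ0 (by norm_num)]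
  rw [e1, e2] at hsq
  -- (6) conclude
  have hK1 : (K : ℝ) ^ 2 * Zen v ≤ ((K : ℝ) + 1) ^ 2 * Zen v :=
    mul_le_mul_of_nonneg_right (pow_le_pow_left₀ hK0 (by linarith) 2) hZ0
  have hden : 0 < 4 * ((K : ℝ) + 1) ^ 2 := by positivity
  rw [show w ^ ((1 : ℝ) / 3) / (4 * ((K : ℝ) + 1) ^ 2) * (R * lam v) * M ^ 2 =
      ((M / 2) ^ 2 * (r * w ^ ((1 : ℝ) / 3))) / ((K : ℝ) + 1) ^ 2 by rw [hrdef]; field_simp; ring,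
    div_le_iff₀ (by positivity)]
  calc (M / 2) ^ 2 * (r * w ^ ((1 : ℝ) / 3)) ≤ (K : ℝ) ^ 2 * Zen v := hsq
    _ ≤ ((K : ℝ) + 1) ^ 2 * Zen v := hK1
    _ = Zen v * ((K : ℝ) + 1) ^ 2 := mul_comm _ _

end Summit.NavierStokesRegularity.NavierStokesRegularity.Theorems.NearExtremalTransiencePerFlow.AnalyticGap

end
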